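import Summits.RiemannHypothesis.RiemannHypothesis.Theorems.WeilArchPanelsN1075ENe1075v1D
import HarnessLib

/-!
# G3 A-layer data: panel certificates — window vector `ne1075v1` (`v(x) = P(x/b)`, b = 43/40, 30 panels)

Generated by `cert/abgen/panels.py` (prover A g12 cellgen; run by prover A g25 (A g24 kit) for the SHARP parity-ladder U-side (kernel scale 2^140, Kφ 64, 45-digit panel polynomials, exact per-panel budgets) at b = 43/40; dyadic penalty polynomial in `y = x/b`).
Kernel-checked by `decide +kernel`, each theorem a few seconds. [folklore]
-/

set_option linter.dupNamespace false

namespace Summit.RiemannHypothesis.RiemannHypothesis.Theorems.EvenWinsBeyondArch.ArchN1075E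

open Literature.NumberTheory.LFunctions Literature.Analysis.ValidatedNumerics.PolyMP Literature.Analysis.ValidatedNumerics.NumericsMP Literature.Analysis.ValidatedNumerics.ExpPoly

set_option maxHeartbeats 0 in
/-- panel 12. [folklore] -/
theorem ne1075v1_pc12 : archPanelCheck 1393796574908163946345982392040522594123776 (1 / 30) 22 14 64 5 20 4 12 (ne1075v1Qs.getD 12 []) 1024 (ne1075v1ps.getD 12 []) ne1075v1E (((43 : ℚ)/40)) (ne1075v1Ilo.getD 12 0) (ne1075v1Ihi.getD 12 0) = true := by decide +kernel

set_option maxHeartbeats 0 in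
/-- panel 13. [folklore] -/
theorem ne1075v1_pc13 : archPanelCheck 1393796574908163946345982392040522594123776 (1 / 30) 22 14 64 5 20 4 13 (ne1075v1Qs.getD 13 []) 1024 (ne1075v1ps.getD 13 []) ne1075v1E (((43 : ℚ)/40)) (ne1075v1Ilo.getD 13 0) (ne1075v1Ihi.getD 13 0) = true := by decide +kernel

set_option maxHeartbeats 0 in
/-- panel 14. [folklore] -/
theorem ne1075v1_pc14 : archPanelCheck 1393796574908163946345982392040522594123776 (1 / 30) 22 14 64 5 20 4 14 (ne1075v1Qs.getD 14 []) 1024 (ne1075v1ps.getD 14 []) ne1075v1E (((43 : ℚ)/40)) (ne1075v1Ilo.getD 14 0) (ne1075v1Ihi.getD 14 0) = true := by decide +kernel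

set_option maxHeartbeats 0 in
/-- panel 15. [folklore] -/
theorem ne1075v1_pc15 : archPanelCheck 1393796574908163946345982392040522594123776 (1 / 30) 22 14 64 5 20 4 15 (ne1075v1Qs.getD 15 []) 1024 (ne1075v1ps.getD 15 []) ne1075v1E (((43 : ℚ)/40)) (ne1075v1Ilo.getD 15 0) (ne1075v1Ihi.getD 15 0) = true := by decide +kernel

set_option maxHeartbeats 0 in
/-- panel 16. [folklore] -/
theorem ne1075v1_pc16 : archPanelCheck 1393796574908163946345982392040522594123776 (1 / 30) 22 14 64 5 20 4 16 (ne1075v1Qs.getD 16 []) 1024 (ne1075v1ps.getD 16 []) ne1075v1E (((43 : ℚ)/40)) (ne1075v1Ilo.getD 16 0) (ne1075v1Ihi.getD 16 0) = true := by decide +kernel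

set_option maxHeartbeats 0 in
/-- panel 17. [folklore] -/
theorem ne1075v1_pc17 : archPanelCheck 1393796574908163946345982392040522594123776 (1 / 30) 22 14 64 5 20 4 17 (ne1075v1Qs.getD 17 []) 1024 (ne1075v1ps.getD 17 []) ne1075v1E (((43 : ℚ)/40)) (ne1075v1Ilo.getD 17 0) (ne1075v1Ihi.getD 17 0) = true := by decide +kernel

end Summit.RiemannHypothesis.RiemannHypothesis.Theorems.EvenWinsBeyondArch.ArchN1075E
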